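import Summits.Ventures.Crystal3D.Bulk.CapBoxSproc
import Summits.Ventures.Crystal3D.Bulk.CapX2Poly3
import Summits.Ventures.Crystal3D.Bulk.CapX2DataW06225X2
import HarnessLib

/-!
# X2 certificate `certW06225` (level `-0.6225`): compiled check `checkII_13hi_110_W06225`

Venture `Crystal3D` (cell `pub-crystal3d`, phase 2; seat typer-bulk). One of the Boolean evaluations behind
`CapX2.noHole_06225` (`CapX2BoxW06225.lean`): the S-procedure tensor-Bernstein check `Bern.checkPos3S`
(`CapBoxSproc.lean`, soundness on the standard axioms) of the negated, padded (II) tensor `-(P+λ)` (degree `28`) on the sub-box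
`u ∈ [-173/800, 19/100]`, `v ∈ [4/5, 1]`, `t ∈ [-1/4, 1/8]`, evaluated by `native_decide` (compiled code trusted — the
class of the tree's `KissingSearch` parts). One compiled search per file keeps each gate elaboration under its
wall. HONEST FRAMING: a computation; its meaning is given by `Bern.nonneg_of_checkPos3S`.
-/

namespace Summit.Ventures.Crystal3D.CapX2

/-- The check evaluates to `true`. [folklore] -/
theorem checkII_13hi_110_W06225 :
    CapCut.Bern.checkPos3S (CapCut.Bern.pad3 28 (scale3 (-1) (pairPolyZ certW06225 lamW06225))) 28
      (-173 / 800) (19 / 100) (4 / 5) 1 (-1 / 4) (1 / 8) 80 40 64 = true := by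
  native_decide

end Summit.Ventures.Crystal3D.CapX2
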